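import Summits.Ventures.PercRepro.Night2LineRank
import Summits.Ventures.PercRepro.Night2HighTop

/-!
# night-2: THE SMALL CELLS `|W| = 10, 11` AND THE LINE-FREE CELLS (gen 39)

The rank cells (Night2LineRank): `(d, k) = (8, 3)` (`q = 2`: the family `O`, `1.12`; `q ≤ 1`: `O` and `O ∖ {y}`, `4.70 / 5.39`),
`(7, 4)` (`O` and `O ∖ {y}`: `1.67 / 1.85 / 2.16`), `(8, 2)` (`q ≤ 1`: `O`, `1.28 / 1.48`; `q = 2`: gen 37's line + 2), `(7, 3)`
(`q ≤ 1`: `1.98 / 2.26`).  Hence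
* **`basis_pair_fair_of_eleven_seven_collinear`**: `|W| = 11` with seven collinear points of `W` ⇒ fair (with
  `basis_pair_fair_of_eleven_lines_le_four` the open cells at `|W| = 11` are exactly a longest line of `5` or `6` points);
* **`basis_pair_fair_of_ten_eight_collinear`**: `|W| = 10` with eight collinear points of `W` ⇒ fair;
* the line-free cells of `G` itself: **`localShadowHall_two_one_of_lines_le_four`** (`|G| ≥ 17`, no five collinear points of `G`),
  **`localShadowHall_two_one_of_lines_le_three`** (`|G| ≥ 15`, no four collinear), **`localShadowHall_two_one_of_lines_le_two`**
  (`|G| ≥ 14`, no three collinear) — h21's cell `(2, 1)` there.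
Paper: proofs/NIGHT-2-g39.md §5.
-/

namespace PercRepro.Shadow

open PercRepro.ThmH PercRepro.PerFlat

variable {α : Type*} [DecidableEq α] {M : Matroid α} [M.Finite] {G : Finset α}

/-- `lineRankIncome 2 8 3 ≥ 1` (`1.118`). -/
theorem one_le_lineRankIncome_two_eight_three : 1 ≤ lineRankIncome 2 8 3 := by
  unfold lineRankIncome
  simp only [Finset.sum_range_succ, Finset.sum_range_zero]
  norm_num [lineFaceBound, Nat.choose]

/-- `lineRankIncome q 8 3 + 3 · lineRankIncome q 8 2 ≥ 1` for `q ≤ 1` (`4.70 / 5.39`). -/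
theorem one_le_lineRankIncome_plus_eight_three {q : ℕ} (hq : q ≤ 1) :
    1 ≤ lineRankIncome q 8 3 + ((3 : ℕ) : ℚ) * lineRankIncome q 8 (3 - 1) := by
  interval_cases q <;>
    (unfold lineRankIncome
     simp only [Finset.sum_range_succ, Finset.sum_range_zero]
     norm_num [lineFaceBound, Nat.choose])

/-- `lineRankIncome q 7 4 + 4 · lineRankIncome q 7 3 ≥ 1` for `q ≤ 2` (`1.67 / 1.85 / 2.16`). -/
theorem one_le_lineRankIncome_plus_seven_four {q : ℕ} (hq : q ≤ 2) :
    1 ≤ lineRankIncome q 7 4 + ((4 : ℕ) : ℚ) * lineRankIncome q 7 (4 - 1) := by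
  interval_cases q <;>
    (unfold lineRankIncome
     simp only [Finset.sum_range_succ, Finset.sum_range_zero]
     norm_num [lineFaceBound, Nat.choose])

/-- `lineRankIncome q 8 2 ≥ 1` for `q ≤ 1` (`1.28 / 1.48`). -/
theorem one_le_lineRankIncome_eight_two {q : ℕ} (hq : q ≤ 1) : 1 ≤ lineRankIncome q 8 2 := by
  interval_cases q <;>
    (unfold lineRankIncome
     simp only [Finset.sum_range_succ, Finset.sum_range_zero]
     norm_num [lineFaceBound, Nat.choose])

/-- `lineRankIncome q 7 3 + 3 · lineRankIncome q 7 2 ≥ 1` for `q ≤ 1` (`1.98 / 2.26`). -/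
theorem one_le_lineRankIncome_plus_seven_three {q : ℕ} (hq : q ≤ 1) :
    1 ≤ lineRankIncome q 7 3 + ((3 : ℕ) : ℚ) * lineRankIncome q 7 (3 - 1) := by
  interval_cases q <;>
    (unfold lineRankIncome
     simp only [Finset.sum_range_succ, Finset.sum_range_zero]
     norm_num [lineFaceBound, Nat.choose])

/-- **The cell `(8, 3)`**: eight points of `W` on a line, three off it ⇒ fair (every `q`). -/
theorem basis_pair_fair_of_eight_three (hG : G ∈ flatsQ M (5 + 1)) (hd : (gr M \ G).card = 2)
    (hk : kColoops M G = 1) (hs : ∀ e ∈ gr M, ∀ f ∈ gr M, e ≠ f → rkN M {e, f} = 2)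
    (hl : ∀ e ∈ gr M, M.Indep {e}) (hnf : fatClosures M 5 G 2 = ∅) {B : Finset α}
    (hB : B ∈ thinMembers M 5 G) (hnP : ¬ bigP M G B) {z : α} (hz : z ∈ G \ clF M B)
    (hl0 : loss M 5 G B z ≠ 0) {x y : α}
    (hd8 : 8 ≤ ((G \ insert z B) ∩ clF M {x, y}).card) (hk3 : ((G \ insert z B) \ clF M {x, y}).card = 3) :
    loss M 5 G B z ≤ rhoL M 5 G B z * lossIncomeH M 5 G (bigP M G) (dshGT2 M 5 G) B z := by
  have hind : M.Indep ((insert z B \ coloops M G : Finset α) : Set α) :=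
    (indep_insert_of_basis_pair hG hd hk hB hnP hz).subset (by exact_mod_cast (Finset.sdiff_subset))
  have hq2 := card_inter_clF_pair_le_two_of_indep hind (a := x) (b := y)
  rcases Nat.lt_or_ge ((insert z B \ coloops M G) ∩ clF M {x, y}).card 2 with hq1 | hq2'
  · exact basis_pair_fair_of_line_rank_plus hG hd hk hs hl hnf hB hnP hz hl0 hk3 (by omega) hd8
      (one_le_lineRankIncome_plus_eight_three (by omega))
  · have hq : ((insert z B \ coloops M G) ∩ clF M {x, y}).card = 2 := by omega
    apply basis_pair_fair_of_line_rank_one hG hd hk hs hl hnf hB hnP hz hl0 hk3 (by omega) hd8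
    rw [hq]
    exact one_le_lineRankIncome_two_eight_three

/-- **The cell `(7, 4)`**: seven points of `W` on a line, four off it ⇒ fair (every `q`). -/
theorem basis_pair_fair_of_seven_four (hG : G ∈ flatsQ M (5 + 1)) (hd : (gr M \ G).card = 2)
    (hk : kColoops M G = 1) (hs : ∀ e ∈ gr M, ∀ f ∈ gr M, e ≠ f → rkN M {e, f} = 2)
    (hl : ∀ e ∈ gr M, M.Indep {e}) (hnf : fatClosures M 5 G 2 = ∅) {B : Finset α}
    (hB : B ∈ thinMembers M 5 G) (hnP : ¬ bigP M G B) {z : α} (hz : z ∈ G \ clF M B)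
    (hl0 : loss M 5 G B z ≠ 0) {x y : α}
    (hd7 : 7 ≤ ((G \ insert z B) ∩ clF M {x, y}).card) (hk4 : ((G \ insert z B) \ clF M {x, y}).card = 4) :
    loss M 5 G B z ≤ rhoL M 5 G B z * lossIncomeH M 5 G (bigP M G) (dshGT2 M 5 G) B z := by
  have hind : M.Indep ((insert z B \ coloops M G : Finset α) : Set α) :=
    (indep_insert_of_basis_pair hG hd hk hB hnP hz).subset (by exact_mod_cast (Finset.sdiff_subset))
  have hq2 := card_inter_clF_pair_le_two_of_indep hind (a := x) (b := y)
  exact basis_pair_fair_of_line_rank_plus hG hd hk hs hl hnf hB hnP hz hl0 hk4 (by omega) hd7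
    (one_le_lineRankIncome_plus_seven_four hq2)

/-- **The cell `(8, 2)`**: eight points of `W` on a line, two off it ⇒ fair (every `q`; `q = 2` by gen 37's line + 2). -/
theorem basis_pair_fair_of_eight_two (hG : G ∈ flatsQ M (5 + 1)) (hd : (gr M \ G).card = 2)
    (hk : kColoops M G = 1) (hs : ∀ e ∈ gr M, ∀ f ∈ gr M, e ≠ f → rkN M {e, f} = 2)
    (hl : ∀ e ∈ gr M, M.Indep {e}) (hnf : fatClosures M 5 G 2 = ∅) {B : Finset α}
    (hB : B ∈ thinMembers M 5 G) (hnP : ¬ bigP M G B) {z : α} (hz : z ∈ G \ clF M B)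
    (hl0 : loss M 5 G B z ≠ 0) {x y : α}
    (hd8 : 8 ≤ ((G \ insert z B) ∩ clF M {x, y}).card) (hk2 : ((G \ insert z B) \ clF M {x, y}).card = 2) :
    loss M 5 G B z ≤ rhoL M 5 G B z * lossIncomeH M 5 G (bigP M G) (dshGT2 M 5 G) B z := by
  have hind : M.Indep ((insert z B \ coloops M G : Finset α) : Set α) :=
    (indep_insert_of_basis_pair hG hd hk hB hnP hz).subset (by exact_mod_cast (Finset.sdiff_subset))
  have hq2 := card_inter_clF_pair_le_two_of_indep hind (a := x) (b := y)
  rcases Nat.lt_or_ge ((insert z B \ coloops M G) ∩ clF M {x, y}).card 2 with hq1 | hq2'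
  · exact basis_pair_fair_of_line_rank_one hG hd hk hs hl hnf hB hnP hz hl0 hk2 (by omega) hd8
      (one_le_lineRankIncome_eight_two (by omega))
  · exact basis_pair_fair_of_line_two_off_basis hG hd hk hs hl hnf hB hnP hz hl0 (by omega) hk2

/-- **The cell `(7, 3)` with at most one basis point on the line** ⇒ fair. -/
theorem basis_pair_fair_of_seven_three (hG : G ∈ flatsQ M (5 + 1)) (hd : (gr M \ G).card = 2)
    (hk : kColoops M G = 1) (hs : ∀ e ∈ gr M, ∀ f ∈ gr M, e ≠ f → rkN M {e, f} = 2)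
    (hl : ∀ e ∈ gr M, M.Indep {e}) (hnf : fatClosures M 5 G 2 = ∅) {B : Finset α}
    (hB : B ∈ thinMembers M 5 G) (hnP : ¬ bigP M G B) {z : α} (hz : z ∈ G \ clF M B)
    (hl0 : loss M 5 G B z ≠ 0) {x y : α}
    (hq : ((insert z B \ coloops M G) ∩ clF M {x, y}).card ≤ 1)
    (hd7 : 7 ≤ ((G \ insert z B) ∩ clF M {x, y}).card) (hk3 : ((G \ insert z B) \ clF M {x, y}).card = 3) :
    loss M 5 G B z ≤ rhoL M 5 G B z * lossIncomeH M 5 G (bigP M G) (dshGT2 M 5 G) B z :=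
  basis_pair_fair_of_line_rank_plus hG hd hk hs hl hnf hB hnP hz hl0 hk3 (by omega) hd7
    (one_le_lineRankIncome_plus_seven_three hq)

/-- **`|W| = 11` with seven collinear points of `W` ⇒ fair**: `d ≥ 9` by the hitting line theorem, `(8, 3)`, `(7, 4)`. -/
theorem basis_pair_fair_of_eleven_seven_collinear (hG : G ∈ flatsQ M (5 + 1)) (hd : (gr M \ G).card = 2)
    (hk : kColoops M G = 1) (hs : ∀ e ∈ gr M, ∀ f ∈ gr M, e ≠ f → rkN M {e, f} = 2)
    (hl : ∀ e ∈ gr M, M.Indep {e}) (hnf : fatClosures M 5 G 2 = ∅) {B : Finset α}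
    (hB : B ∈ thinMembers M 5 G) (hnP : ¬ bigP M G B) {z : α} (hz : z ∈ G \ clF M B)
    (hl0 : loss M 5 G B z ≠ 0) (hN : (G \ insert z B).card = 11) {x y : α} (hx : x ∈ G \ insert z B)
    (hy : y ∈ G \ insert z B) (hxy : x ≠ y) (hd7 : 7 ≤ ((G \ insert z B) ∩ clF M {x, y}).card) :
    loss M 5 G B z ≤ rhoL M 5 G B z * lossIncomeH M 5 G (bigP M G) (dshGT2 M 5 G) B z := by
  have hsplit := Finset.card_sdiff_add_card_inter (G \ insert z B) (clF M {x, y})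
  rcases Nat.lt_or_ge ((G \ insert z B) ∩ clF M {x, y}).card 8 with h7 | h8
  · exact basis_pair_fair_of_seven_four hG hd hk hs hl hnf hB hnP hz hl0 hd7 (by omega)
  · rcases Nat.lt_or_ge ((G \ insert z B) ∩ clF M {x, y}).card 9 with h8' | h9
    · exact basis_pair_fair_of_eight_three hG hd hk hs hl hnf hB hnP hz hl0 h8 (by omega)
    · exact basis_pair_fair_of_nine_collinear hG hd hk hs hl hnf hB hnP hz hl0
        (mem_sdiff_coloops_of_mem_sdiff_insert hG hd hB hx) (mem_sdiff_coloops_of_mem_sdiff_insert hG hd hB hy)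
        hxy h9 (by omega)

/-- **`|W| = 10` with eight collinear points of `W` ⇒ fair**: `d ≥ 9` by the hitting line theorem, `(8, 2)`. -/
theorem basis_pair_fair_of_ten_eight_collinear (hG : G ∈ flatsQ M (5 + 1)) (hd : (gr M \ G).card = 2)
    (hk : kColoops M G = 1) (hs : ∀ e ∈ gr M, ∀ f ∈ gr M, e ≠ f → rkN M {e, f} = 2)
    (hl : ∀ e ∈ gr M, M.Indep {e}) (hnf : fatClosures M 5 G 2 = ∅) {B : Finset α}
    (hB : B ∈ thinMembers M 5 G) (hnP : ¬ bigP M G B) {z : α} (hz : z ∈ G \ clF M B)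
    (hl0 : loss M 5 G B z ≠ 0) (hN : (G \ insert z B).card = 10) {x y : α} (hx : x ∈ G \ insert z B)
    (hy : y ∈ G \ insert z B) (hxy : x ≠ y) (hd8 : 8 ≤ ((G \ insert z B) ∩ clF M {x, y}).card) :
    loss M 5 G B z ≤ rhoL M 5 G B z * lossIncomeH M 5 G (bigP M G) (dshGT2 M 5 G) B z := by
  have hsplit := Finset.card_sdiff_add_card_inter (G \ insert z B) (clF M {x, y})
  rcases Nat.lt_or_ge ((G \ insert z B) ∩ clF M {x, y}).card 9 with h8' | h9
  · exact basis_pair_fair_of_eight_two hG hd hk hs hl hnf hB hnP hz hl0 hd8 (by omega)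
  · exact basis_pair_fair_of_nine_collinear hG hd hk hs hl hnf hB hnP hz hl0
      (mem_sdiff_coloops_of_mem_sdiff_insert hG hd hB hx) (mem_sdiff_coloops_of_mem_sdiff_insert hG hd hB hy)
      hxy h9 (by omega)

/-- The lines of `G` bound the lines of `W`. -/
theorem lines_W_le_of_lines_G {Q : Finset α} {L : ℕ}
    (hGL : ∀ x ∈ G, ∀ y ∈ G, x ≠ y → (G ∩ clF M {x, y}).card ≤ L) :
    ∀ x ∈ G \ Q, ∀ y ∈ G \ Q, x ≠ y → ((G \ Q) ∩ clF M {x, y}).card ≤ L := by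
  intro x hx y hy hxy
  refine le_trans (Finset.card_le_card ?_) (hGL x (Finset.mem_sdiff.1 hx).1 y (Finset.mem_sdiff.1 hy).1 hxy)
  exact Finset.inter_subset_inter_right Finset.sdiff_subset

/-- **The non-fat cell with no five collinear points of `G` and `|G| ≥ 17`**, no four collinear and `|G| ≥ 15`, or no three
collinear and `|G| ≥ 14`, satisfies the local Hall inequality. -/
theorem localShadowHall_nonfat_of_lines_le (hG : G ∈ flatsQ M (5 + 1)) (hd : (gr M \ G).card = 2)
    (hk : kColoops M G = 1) (hs : ∀ e ∈ gr M, ∀ f ∈ gr M, e ≠ f → rkN M {e, f} = 2)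
    (hl : ∀ e ∈ gr M, M.Indep {e}) (hnf : fatClosures M 5 G 2 = ∅) {L : ℕ}
    (hGL : ∀ x ∈ G, ∀ y ∈ G, x ≠ y → (G ∩ clF M {x, y}).card ≤ L)
    (hcell : (L ≤ 4 ∧ 17 ≤ G.card) ∨ (L ≤ 3 ∧ 15 ≤ G.card) ∨ (L ≤ 2 ∧ 14 ≤ G.card)) :
    LocalShadowHall M 5 G := by
  have hfat : (fatClosures M 5 G 2).card ≤ 1 := by
    rw [hnf, Finset.card_empty]
    exact zero_le_one
  apply localShadowHall_of_gt2_of_basis_fair hG hd hk hs hl hfat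
  intro B hB hnP z hz
  by_cases hl0 : loss M 5 G B z = 0
  · rw [hl0]
    have hd' : (gr M \ G).card ≤ 5 := by omega
    have h1 : 0 ≤ rhoL M 5 G B z := by
      unfold rhoL
      rw [hl0]
      simp
    have h2 : 0 ≤ lossIncomeH M 5 G (bigP M G) (dshGT2 M 5 G) B z :=
      lossIncomeH_nonneg hG hd' (column_side_gt2 hG hd hk hs hl hfat) B z
    positivity
  · have hWL := lines_W_le_of_lines_G (Q := insert z B) hGL
    have hN := card_sdiff_insert_eq_card_sub_six hG hd hk hB hnP hz
    rcases hcell with ⟨hL4, h17⟩ | ⟨hL3, h15⟩ | ⟨hL2, h14⟩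
    · rcases Nat.lt_or_ge G.card 18 with h17' | h18
      · exact basis_pair_fair_of_eleven_lines_le_four hG hd hk hs hl hnf hB hnP hz hl0
          (fun x hx y hy hxy => le_trans (hWL x hx y hy hxy) hL4) (by omega)
      · exact basis_pair_fair_of_twelve hG hd hk hs hl hnf hB hnP hz hl0 (by omega)
    · exact basis_pair_fair_of_lines_le_three hG hd hk hs hl hnf hB hnP hz hl0
        (fun x hx y hy hxy => le_trans (hWL x hx y hy hxy) hL3) (by omega)
    · exact basis_pair_fair_of_lines_le_two hG hd hk hs hl hnf hB hnP hz hl0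
        (fun x hx y hy hxy => le_trans (hWL x hx y hy hxy) hL2) (by omega)

/-- **h21's cell `(2, 1)` with no five collinear points of `G` and `|G| ≥ 17`, no four and `|G| ≥ 15`, or no three and
`|G| ≥ 14`** (the fat cases by gens 28 / 36). -/
theorem localShadowHall_two_one_of_lines_le (hG : G ∈ flatsQ M (5 + 1)) (hd : (gr M \ G).card = 2)
    (hk : kColoops M G = 1) (hs : ∀ e ∈ gr M, ∀ f ∈ gr M, e ≠ f → rkN M {e, f} = 2)
    (hl : ∀ e ∈ gr M, M.Indep {e}) {L : ℕ}
    (hGL : ∀ x ∈ G, ∀ y ∈ G, x ≠ y → (G ∩ clF M {x, y}).card ≤ L)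
    (hcell : (L ≤ 4 ∧ 17 ≤ G.card) ∨ (L ≤ 3 ∧ 15 ≤ G.card) ∨ (L ≤ 2 ∧ 14 ≤ G.card)) :
    LocalShadowHall M 5 G := by
  rcases Nat.lt_or_ge (fatClosures M 5 G 2).card 2 with hlt | hge
  · rcases Nat.lt_or_ge (fatClosures M 5 G 2).card 1 with h0 | h1
    · have hnf : fatClosures M 5 G 2 = ∅ := Finset.card_eq_zero.1 (by omega)
      exact localShadowHall_nonfat_of_lines_le hG hd hk hs hl hnf hGL hcell
    · obtain ⟨B₀, hB₀, hm₀⟩ := exists_fat_member_of_card_eq_one hG hd (by omega)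
      exact localShadowHall_fat hG hd hk hs hl (by omega) hB₀ hm₀
  · exact localShadowHall_two_one_five_fatClosures_free hG hd hk hs hl hge

end PercRepro.Shadow
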